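import Mathlib
import HarnessLib
import Summits.HubbardSuperconductivity.HubbardSuperconductivity.Theorems.KLProgrammeKLRegimeScaleZeroTwoLegTail3
import Summits.HubbardSuperconductivity.HubbardSuperconductivity.Theorems.KLProgrammeKLRegimeEngineV8DoorNumeralU9

/-!
# Route `KLProgramme`, ENGINE child (stmt-…-20437), stub (C) at `n = 0` (located #22, piece (a3)): the PLAIN / ON-SITE pinned sums of the
# order-≥3 tail of the scale-`0` two-leg kernel at the bare frame (companion of `…ScaleZeroTwoLegTail3`)

Cell gate-hubbard-kl, seat p1 (g18).  `…ScaleZeroTwoLegTail3` bounds the OFF-SITE `k`-th spatial moments of `kernel₂ T₃`,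
`T₃ = W₀ − e^{Δ}V + ½(e^{Δ}V² − (e^{Δ}V)²)`, at the bare frame with `δ₀ = √46`.  The receiving slot of #22 (k3c3-p1's
`…FlowReadScaleZeroMixed.twoLegRead_frameZero_of_split_certD`, p608958) also asks, for its moment part `W_a ⊇ T₃`, the ON-SITE row
`(a-on)`: `Σ_{p₁}[x⃗₁ = x⃗₀]‖kernel₂ W_a‖ ≤ v|U|·β/4M`.  This file supplies the tail's share of that row, and the plain sum, in one statement:
**`twoLeg_wsum_tail3_frameZero_le_of_le_one`** — for ANY pair weight `0 ≤ ω ≤ 1` on grid points (the on-site indicator, or `ω ≡ 1`), with `a` the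
normalised UNWEIGHTED row/column size of `SᵀC⁰_{>e₀}S` and `16e⁹·46·a·|U| ≤ 1/2`:
`Σ_{p₁} ω(p₀,p₁)‖kernel₂ T₃ ((p₀,σ,+),(p₁,σ,−))‖ ≤ 2¹³·e²⁷·46³·a²·|U|³·β/(4M)` (`μ ∈ klWindowC`, `klBetaMin ≤ β`, `klEngL₃ β U ≤ L`, every `M ≥ 1`;
the generic door `twoLeg_wsum_tail3_le` at the trivial tree weight `(1 + diam)⁰ ≡ 1`); and §2 BOOKS both tail rows under (C)'s binder
`U ≤ klEngU₀9 P R c` (k3c5-p1's `…EngineV8DoorNumeralU9`: `U ≤ 10⁻³⁷`) into the slot's currencies: off-site `≤ ((2/λ)ᵏ2¹³e²⁷46³a²/10³⁷)·U²·β/4M`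
(**`twoLeg_offDiag_moment_pow_sum_tail3_frameZero_le_booked`**), ω-sum `≤ (2¹³e²⁷46³a²/10⁷⁴)·|U|·β/4M` (**`twoLeg_wsum_tail3_frameZero_le_booked`**).
No definition; everything PROVED.
References: BGM 2006 (2.13)–(2.14), (2.77)–(2.80) [cite: BenfattoGiulianiMastropietro2006]; Pedra–Salmhofer 2008 Thm 2.4 [cite: PedraSalmhofer2008].
-/

noncomputable section

namespace Summit.HubbardSuperconductivity.HubbardSuperconductivity.Theorems.EngineV8

set_option linter.dupNamespace false -- summit = problem name (single-conjunct summit), D-0017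

open Real Finset Literature.MathematicalPhysics.QuantumLattice Literature.Probability.LatticeModels
open Literature.Probability.LatticeModels.BattleFederbush GrassmannAlgebra
open Summit.HubbardSuperconductivity.HubbardSuperconductivity.Theorems.KLRegimeSplit
open Summit.HubbardSuperconductivity.HubbardSuperconductivity.Theorems.DispersionFlow

variable {L : ℕ} [NeZero L]

/-! ## The on-site and the plain pinned sums of the tail at the bare frame (the slot's `(a-on)` row for `W_a ⊇ T₃`) -/

section BareFrameOnSite

variable {M : ℕ} [NeZero M]

/-- **THE PLAIN AND THE ON-SITE PINNED SUMS OF THE ORDER-≥3 TAIL AT THE BARE FRAME**: for `μ ∈ klWindowC`, `0 < U`, `klBetaMin ≤ β`, `klEngL₃ β U ≤ L`,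
every `M ≥ 1`, with `a > 0` the normalised UNWEIGHTED row/column size of the bare scale-`0` grid covariance (`Σ_Y ‖C X Y‖ ≤ a·4M/β`) and `16·e⁹·46·a·|U| ≤ 1/2`,
for any pair weight `0 ≤ ω ≤ 1` on grid points (e.g. the on-site indicator `[x⃗₁ = x⃗₀]` of `…FlowReadScaleZeroMixed`'s row `(a-on)`, or `ω ≡ 1`):
`Σ_{p₁} ω(p₀,p₁)·‖kernel₂ (W₀ − e^{Δ}V + ½(e^{Δ}V² − (e^{Δ}V)²)) ((p₀,σ,+),(p₁,σ,−))‖ ≤ 2¹³·e²⁷·46³·a²·|U|³·β/(4M)`. -/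
theorem twoLeg_wsum_tail3_frameZero_le_of_le_one {μ : ℝ} (hμ : μ ∈ klWindowC) {U : ℝ} (hU : 0 < U) {β : ℝ}
    (hβ : klBetaMin ≤ β) (hL : klEngL₃ β U ≤ L) {a : ℝ} (ha : 0 < a)
    (hrow : ∀ X, ∑ Y, ‖((hubbardGridSub L M β (2 * (2 * M))).transpose * hubbardCovAboveCT L M β μ 0 0 klE0 *
        hubbardGridSub L M β (2 * (2 * M))) X Y‖ ≤ a * ((2 * (2 * M) : ℕ) : ℝ) / β)
    (hcol : ∀ Y, ∑ X, ‖((hubbardGridSub L M β (2 * (2 * M))).transpose * hubbardCovAboveCT L M β μ 0 0 klE0 *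
        hubbardGridSub L M β (2 * (2 * M))) X Y‖ ≤ a * ((2 * (2 * M) : ℕ) : ℝ) / β)
    (hsmall : 16 * Real.exp 1 ^ 9 * 46 * a * |U| ≤ 1 / 2)
    (ω : GridPoint L (2 * (2 * M)) → GridPoint L (2 * (2 * M)) → ℝ) (hω0 : ∀ p q, 0 ≤ ω p q) (hω1 : ∀ p q, ω p q ≤ 1)
    (σ : Fin 2) (p₀ : GridPoint L (2 * (2 * M))) :
    ∑ p₁ : GridPoint L (2 * (2 * M)), ω p₀ p₁ *
      ‖kernel ℂ (effAction ℂ ((hubbardGridSub L M β (2 * (2 * M))).transpose * hubbardCovAboveCT L M β μ 0 0 klE0 *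
              hubbardGridSub L M β (2 * (2 * M))) (hubbardGridInteraction L (2 * (2 * M)) β U) -
          gaussConv ℂ ((hubbardGridSub L M β (2 * (2 * M))).transpose * hubbardCovAboveCT L M β μ 0 0 klE0 *
              hubbardGridSub L M β (2 * (2 * M))) (hubbardGridInteraction L (2 * (2 * M)) β U) +
          (2 : ℂ)⁻¹ • (gaussConv ℂ ((hubbardGridSub L M β (2 * (2 * M))).transpose * hubbardCovAboveCT L M β μ 0 0 klE0 *
                hubbardGridSub L M β (2 * (2 * M)))
              (hubbardGridInteraction L (2 * (2 * M)) β U * hubbardGridInteraction L (2 * (2 * M)) β U) -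
            gaussConv ℂ ((hubbardGridSub L M β (2 * (2 * M))).transpose * hubbardCovAboveCT L M β μ 0 0 klE0 *
                hubbardGridSub L M β (2 * (2 * M))) (hubbardGridInteraction L (2 * (2 * M)) β U) *
            gaussConv ℂ ((hubbardGridSub L M β (2 * (2 * M))).transpose * hubbardCovAboveCT L M β μ 0 0 klE0 *
                hubbardGridSub L M β (2 * (2 * M))) (hubbardGridInteraction L (2 * (2 * M)) β U)))
        2 (fun i => ((![p₀, p₁] i, σ), i))‖ ≤
      (2 : ℝ) ^ 13 * Real.exp 1 ^ 27 * (46 : ℝ) ^ 3 * a ^ 2 * |U| ^ 3 * (β / ((2 * (2 * M) : ℕ) : ℝ)) := by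
  haveI : NeZero (2 * (2 * M)) := ⟨by have := NeZero.ne M; omega⟩
  have hβ0 : 0 < β := lt_of_lt_of_le (by norm_num [klBetaMin]) hβ
  have hN : (0 : ℝ) < ((2 * (2 * M) : ℕ) : ℝ) := by have := NeZero.ne M; positivity
  have h46 : (2 * (7 + 16) : ℝ) = 46 := by norm_num
  have hκ : (0 : ℝ) < Real.sqrt (2 * (7 + 16)) := Real.sqrt_pos.2 (by norm_num)
  have hκsq : Real.sqrt (2 * (7 + 16)) ^ 2 = 46 := by rw [Real.sq_sqrt (by norm_num), h46]
  have hGB := isGramBoundedR_scaleZero_free_klEngL₃ (L := L) (M := M) hμ hβ hL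
  have hα : 0 < a * ((2 * (2 * M) : ℕ) : ℝ) / β := by positivity
  -- the trivial tree weight `(1 + 1·diam)⁰ ≡ 1`
  set wt : Finset (GridLeg (GridPoint L (2 * (2 * M)))) → ℝ := fun S =>
    diamWeight (fun s => (1 + 1 * s) ^ 0) (gridLabelDist L (2 * (2 * M)) β) (S.image gridLegPos) with hwt
  have hwt1 : ∀ S, wt S = 1 := fun S => by simp [hwt, diamWeight]
  have hwtT : IsTreeWeight wt := isTreeWeight_scaledPolyWt (L := L) (N := 2 * (2 * M)) hβ0.le zero_le_one 0
  have hθeq' := theta_frameZero_eq_gen (L := L) (M := M) hβ0 hκ U a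
  have hθeq : Real.exp 1 * (a * ((2 * (2 * M) : ℕ) : ℝ) / β) *
      normV (GridLeg (GridPoint L (2 * (2 * M)))) (Real.sqrt (2 * (7 + 16))) (Real.sqrt (2 * (7 + 16)))
        (fun m' => if m' = 1 then |β| / ((2 * (2 * M) : ℕ) : ℝ) * (0 : TrigPolyC4v).coeffNorm 0
          else if m' = 2 then |U| * |β| / ((2 * (2 * M) : ℕ) : ℝ) else 0) / Real.sqrt (2 * (7 + 16)) ^ 2 =
      16 * Real.exp 1 ^ 9 * 46 * a * |U| := by rw [hθeq', hκsq]
  have hθ0 : 0 ≤ 16 * Real.exp 1 ^ 9 * 46 * a * |U| := by positivity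
  have hθlt : Real.exp 1 * (a * ((2 * (2 * M) : ℕ) : ℝ) / β) *
      normV (GridLeg (GridPoint L (2 * (2 * M)))) (Real.sqrt (2 * (7 + 16))) (Real.sqrt (2 * (7 + 16)))
        (fun m' => if m' = 1 then |β| / ((2 * (2 * M) : ℕ) : ℝ) * (0 : TrigPolyC4v).coeffNorm 0
          else if m' = 2 then |U| * |β| / ((2 * (2 * M) : ℕ) : ℝ) else 0) / Real.sqrt (2 * (7 + 16)) ^ 2 < 1 := by
    rw [hθeq]; exact hsmall.trans_lt (by norm_num)
  have hP0 : ∀ m', 0 ≤ (if m' = 1 then |β| / ((2 * (2 * M) : ℕ) : ℝ) * (0 : TrigPolyC4v).coeffNorm 0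
      else if m' = 2 then |U| * |β| / ((2 * (2 * M) : ℕ) : ℝ) else 0 : ℝ) := fun m' => by
    have := TrigPolyC4v.coeffNorm_nonneg 0 (0 : TrigPolyC4v); split_ifs <;> positivity
  -- the string weight `Ω(Y) := ω (Y 0).pt (Y 1).pt ≤ 1 = 1·wt`
  set Ω : (Fin 2 → GridLeg (GridPoint L (2 * (2 * M)))) → ℝ := fun Y => ω (Y 0).1.1 (Y 1).1.1 with hΩ
  have h := twoLeg_wsum_tail3_le (L := L) (N := 2 * (2 * M)) _ β U hwtT hκ hGB _ hP0
    (fun m' j w => by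
      have h1 := sum_norm_kernel_hubbardGridInteraction_mul_scaledPolyWt_le (L := L) (N := 2 * (2 * M)) β U (β' := β) 1 0 m' j w
      simp only [diamWeight, pow_zero, mul_one] at h1
      simpa only [hwt1, mul_one] using h1)
    hα (fun X => by simpa only [hwt1, mul_one] using hrow X) (fun Y => by simpa only [hwt1, mul_one] using hcol Y) hκ hθlt
    Ω zero_le_one (fun Y => by rw [hwt1, mul_one]; exact hω1 _ _) (((p₀, σ), 0))
  have hstring := sum_point_string_le_sum_pinned (L := L) (N := 2 * (2 * M))
    (fun Y => Ω Y * ‖kernel ℂ (effAction ℂ ((hubbardGridSub L M β (2 * (2 * M))).transpose * hubbardCovAboveCT L M β μ 0 0 klE0 *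
              hubbardGridSub L M β (2 * (2 * M))) (hubbardGridInteraction L (2 * (2 * M)) β U) -
          gaussConv ℂ ((hubbardGridSub L M β (2 * (2 * M))).transpose * hubbardCovAboveCT L M β μ 0 0 klE0 *
              hubbardGridSub L M β (2 * (2 * M))) (hubbardGridInteraction L (2 * (2 * M)) β U) +
          (2 : ℂ)⁻¹ • (gaussConv ℂ ((hubbardGridSub L M β (2 * (2 * M))).transpose * hubbardCovAboveCT L M β μ 0 0 klE0 *
                hubbardGridSub L M β (2 * (2 * M)))
              (hubbardGridInteraction L (2 * (2 * M)) β U * hubbardGridInteraction L (2 * (2 * M)) β U) -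
            gaussConv ℂ ((hubbardGridSub L M β (2 * (2 * M))).transpose * hubbardCovAboveCT L M β μ 0 0 klE0 *
                hubbardGridSub L M β (2 * (2 * M))) (hubbardGridInteraction L (2 * (2 * M)) β U) *
            gaussConv ℂ ((hubbardGridSub L M β (2 * (2 * M))).transpose * hubbardCovAboveCT L M β μ 0 0 klE0 *
                hubbardGridSub L M β (2 * (2 * M))) (hubbardGridInteraction L (2 * (2 * M)) β U))) 2 Y‖)
    (fun Y => mul_nonneg (hω0 _ _) (norm_nonneg _)) σ p₀
  refine le_trans ?_ (h.trans ?_)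
  · refine le_trans (le_of_eq ?_) hstring
    exact sum_congr rfl fun p₁ _ => by simp only [hΩ, Matrix.cons_val_zero, Matrix.cons_val_one, Matrix.cons_val_fin_one]
  rw [one_mul, hθeq]
  have hnV := normV_frameZero_eq (L := L) (M := M) (Real.sqrt (2 * (7 + 16))) (Real.sqrt (2 * (7 + 16))) β U
  rw [hnV]
  have he2 : Real.exp 2 = Real.exp 1 ^ 2 := by rw [← Real.exp_nat_mul]; norm_num
  have hθle : 16 * Real.exp 1 ^ 9 * 46 * a * |U| ≤ 1 / 2 := hsmall
  have hX : 0 ≤ (Real.sqrt (2 * (7 + 16)))⁻¹ ^ 2 *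
      (Real.exp 1 * ((Real.exp 2 * (Real.sqrt (2 * (7 + 16)) + Real.sqrt (2 * (7 + 16)))) ^ 4 *
        (|U| * |β| / ((2 * (2 * M) : ℕ) : ℝ)))) := by positivity
  have hfrac : (Real.sqrt (2 * (7 + 16)))⁻¹ ^ 2 *
      (Real.exp 1 * ((Real.exp 2 * (Real.sqrt (2 * (7 + 16)) + Real.sqrt (2 * (7 + 16)))) ^ 4 *
        (|U| * |β| / ((2 * (2 * M) : ℕ) : ℝ)))) * (16 * Real.exp 1 ^ 9 * 46 * a * |U|) ^ 2 /
        (1 - 16 * Real.exp 1 ^ 9 * 46 * a * |U|) ≤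
      2 * ((Real.sqrt (2 * (7 + 16)))⁻¹ ^ 2 *
      (Real.exp 1 * ((Real.exp 2 * (Real.sqrt (2 * (7 + 16)) + Real.sqrt (2 * (7 + 16)))) ^ 4 *
        (|U| * |β| / ((2 * (2 * M) : ℕ) : ℝ))))) * (16 * Real.exp 1 ^ 9 * 46 * a * |U|) ^ 2 := by
    rw [div_le_iff₀ (by linarith)]
    have hsq : 0 ≤ (16 * Real.exp 1 ^ 9 * 46 * a * |U|) ^ 2 := sq_nonneg _
    nlinarith [mul_nonneg hX hsq]
  refine hfrac.trans (le_of_eq ?_)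
  rw [abs_of_pos hβ0, abs_of_pos hU, he2]
  field_simp
  norm_num

end BareFrameOnSite

/-! ## Booking the tail rows under (C)'s coupling door `U ≤ klEngU₀9 P R c ≤ 10⁻³⁷` (slot currencies `b·U²·β/4M`, `v·|U|·β/4M`) -/

section Booked

variable {M : ℕ} [NeZero M]

/-- `0 < U ≤ klEngU₀9 P R c` ⇒ `|U|³ ≤ U²/10³⁷`. -/
theorem abs_pow_three_le_sq_div_of_le_klEngU₀9 {P : SplitConsts} {R : RenConsts} {c U : ℝ} (hU : 0 < U) (hUle : U ≤ klEngU₀9 P R c) :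
    |U| ^ 3 ≤ U ^ 2 / (10 : ℝ) ^ 37 := by
  have h := le_inv_ten_pow_37_of_le_klEngU₀9 hUle
  rw [abs_of_pos hU, pow_succ]
  have hU2 : (0 : ℝ) ≤ U ^ 2 := by positivity
  calc U ^ 2 * U ≤ U ^ 2 * (1 / (10 : ℝ) ^ 37) := mul_le_mul_of_nonneg_left h hU2
    _ = U ^ 2 / (10 : ℝ) ^ 37 := by ring

/-- `0 < U ≤ klEngU₀9 P R c` ⇒ `|U|³ ≤ |U|/10⁷⁴`. -/
theorem abs_pow_three_le_abs_div_of_le_klEngU₀9 {P : SplitConsts} {R : RenConsts} {c U : ℝ} (hU : 0 < U) (hUle : U ≤ klEngU₀9 P R c) :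
    |U| ^ 3 ≤ |U| / (10 : ℝ) ^ 74 := by
  have h := le_inv_ten_pow_37_of_le_klEngU₀9 hUle
  rw [abs_of_pos hU]
  have h2 : U ^ 2 ≤ (1 / (10 : ℝ) ^ 37) ^ 2 := pow_le_pow_left₀ hU.le h 2
  calc U ^ 3 = U * U ^ 2 := by ring
    _ ≤ U * (1 / (10 : ℝ) ^ 37) ^ 2 := mul_le_mul_of_nonneg_left h2 hU.le
    _ = U / (10 : ℝ) ^ 74 := by ring

/-- **THE OFF-SITE TAIL ROWS IN SLOT CURRENCY**: under (C)'s binders (`μ ∈ klWindowC`, `0 < U ≤ klEngU₀9 P R c`, `klBetaMin ≤ β`, `klEngL₃ β U ≤ L`),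
with the `(1+λ·diam)ᵏ`-weighted size `a` and `16e⁹·46·a·|U| ≤ 1/2`:
`Σ_{p₁}[x⃗₁ ≠ x⃗₀](1+|Δx̃₀|+|Δx̃₁|)ᵏ‖kernel₂ T₃‖ ≤ ((2/λ)ᵏ·2¹³e²⁷46³a²/10³⁷)·U²·β/(4M)` — the `b_k·U²·β/4M` shape of
`…FlowReadScaleZeroMixed.twoLegRead_frameZero_of_split_certD`'s row `(a-off)` for the tail share of `W_a`. -/
theorem twoLeg_offDiag_moment_pow_sum_tail3_frameZero_le_booked {P : SplitConsts} {R : RenConsts} {c : ℝ} {μ : ℝ} (hμ : μ ∈ klWindowC)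
    {U : ℝ} (hU : 0 < U) (hUle : U ≤ klEngU₀9 P R c) {β : ℝ} (hβ : klBetaMin ≤ β) (hL : klEngL₃ β U ≤ L) (k : ℕ) {lam : ℝ}
    (hlam0 : 0 < lam) (hlam1 : lam ≤ 1) {a : ℝ} (ha : 0 < a)
    (hrow : ∀ X, ∑ Y, ‖((hubbardGridSub L M β (2 * (2 * M))).transpose * hubbardCovAboveCT L M β μ 0 0 klE0 *
        hubbardGridSub L M β (2 * (2 * M))) X Y‖ *
        diamWeight (fun s => (1 + lam * s) ^ k) (gridLabelDist L (2 * (2 * M)) β) {gridLegPos X, gridLegPos Y} ≤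
          a * ((2 * (2 * M) : ℕ) : ℝ) / β)
    (hcol : ∀ Y, ∑ X, ‖((hubbardGridSub L M β (2 * (2 * M))).transpose * hubbardCovAboveCT L M β μ 0 0 klE0 *
        hubbardGridSub L M β (2 * (2 * M))) X Y‖ *
        diamWeight (fun s => (1 + lam * s) ^ k) (gridLabelDist L (2 * (2 * M)) β) {gridLegPos X, gridLegPos Y} ≤
          a * ((2 * (2 * M) : ℕ) : ℝ) / β)
    (hsmall : 16 * Real.exp 1 ^ 9 * 46 * a * |U| ≤ 1 / 2)
    (σ : Fin 2) (p₀ : GridPoint L (2 * (2 * M))) :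
    ∑ p₁ : GridPoint L (2 * (2 * M)), (if p₁.2 - p₀.2 = 0 then (0 : ℝ) else
        (1 + (((p₁.2 - p₀.2) 0).valMinAbs.natAbs : ℝ) + (((p₁.2 - p₀.2) 1).valMinAbs.natAbs : ℝ)) ^ k) *
      ‖kernel ℂ (effAction ℂ ((hubbardGridSub L M β (2 * (2 * M))).transpose * hubbardCovAboveCT L M β μ 0 0 klE0 *
              hubbardGridSub L M β (2 * (2 * M))) (hubbardGridInteraction L (2 * (2 * M)) β U) -
          gaussConv ℂ ((hubbardGridSub L M β (2 * (2 * M))).transpose * hubbardCovAboveCT L M β μ 0 0 klE0 *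
              hubbardGridSub L M β (2 * (2 * M))) (hubbardGridInteraction L (2 * (2 * M)) β U) +
          (2 : ℂ)⁻¹ • (gaussConv ℂ ((hubbardGridSub L M β (2 * (2 * M))).transpose * hubbardCovAboveCT L M β μ 0 0 klE0 *
                hubbardGridSub L M β (2 * (2 * M)))
              (hubbardGridInteraction L (2 * (2 * M)) β U * hubbardGridInteraction L (2 * (2 * M)) β U) -
            gaussConv ℂ ((hubbardGridSub L M β (2 * (2 * M))).transpose * hubbardCovAboveCT L M β μ 0 0 klE0 *
                hubbardGridSub L M β (2 * (2 * M))) (hubbardGridInteraction L (2 * (2 * M)) β U) *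
            gaussConv ℂ ((hubbardGridSub L M β (2 * (2 * M))).transpose * hubbardCovAboveCT L M β μ 0 0 klE0 *
                hubbardGridSub L M β (2 * (2 * M))) (hubbardGridInteraction L (2 * (2 * M)) β U)))
        2 (fun i => ((![p₀, p₁] i, σ), i))‖ ≤
      (2 / lam) ^ k * ((2 : ℝ) ^ 13 * Real.exp 1 ^ 27 * (46 : ℝ) ^ 3 * a ^ 2) / (10 : ℝ) ^ 37 * U ^ 2 *
        (β / ((2 * (2 * M) : ℕ) : ℝ)) := by
  have hβ0 : 0 < β := lt_of_lt_of_le (by norm_num [klBetaMin]) hβ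
  have hN : (0 : ℝ) < ((2 * (2 * M) : ℕ) : ℝ) := by have := NeZero.ne M; positivity
  have h := twoLeg_offDiag_moment_pow_sum_tail3_frameZero_le (L := L) (M := M) hμ hU hβ hL k hlam0 hlam1 ha hrow hcol hsmall σ p₀
  refine h.trans ?_
  have h3 := abs_pow_three_le_sq_div_of_le_klEngU₀9 hU hUle
  have hC : 0 ≤ (2 / lam) ^ k * ((2 : ℝ) ^ 13 * Real.exp 1 ^ 27 * (46 : ℝ) ^ 3 * a ^ 2) * (β / ((2 * (2 * M) : ℕ) : ℝ)) := by
    positivity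
  calc (2 / lam) ^ k * ((2 : ℝ) ^ 13 * Real.exp 1 ^ 27 * (46 : ℝ) ^ 3 * a ^ 2 * |U| ^ 3 * (β / ((2 * (2 * M) : ℕ) : ℝ)))
      = (2 / lam) ^ k * ((2 : ℝ) ^ 13 * Real.exp 1 ^ 27 * (46 : ℝ) ^ 3 * a ^ 2) * (β / ((2 * (2 * M) : ℕ) : ℝ)) * |U| ^ 3 := by ring
    _ ≤ (2 / lam) ^ k * ((2 : ℝ) ^ 13 * Real.exp 1 ^ 27 * (46 : ℝ) ^ 3 * a ^ 2) * (β / ((2 * (2 * M) : ℕ) : ℝ)) * (U ^ 2 / (10 : ℝ) ^ 37) :=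
        mul_le_mul_of_nonneg_left h3 hC
    _ = _ := by ring

/-- **THE ω-WEIGHTED (ON-SITE / PLAIN) TAIL ROW IN SLOT CURRENCY**: under (C)'s binders, with the UNWEIGHTED size `a`, `16e⁹·46·a·|U| ≤ 1/2` and any pair
weight `0 ≤ ω ≤ 1`: `Σ_{p₁} ω(p₀,p₁)‖kernel₂ T₃‖ ≤ (2¹³e²⁷46³a²/10⁷⁴)·|U|·β/(4M)` — the `v·|U|·β/4M` shape of the slot's row `(a-on)` (tail share). -/
theorem twoLeg_wsum_tail3_frameZero_le_booked {P : SplitConsts} {R : RenConsts} {c : ℝ} {μ : ℝ} (hμ : μ ∈ klWindowC) {U : ℝ} (hU : 0 < U)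
    (hUle : U ≤ klEngU₀9 P R c) {β : ℝ} (hβ : klBetaMin ≤ β) (hL : klEngL₃ β U ≤ L) {a : ℝ} (ha : 0 < a)
    (hrow : ∀ X, ∑ Y, ‖((hubbardGridSub L M β (2 * (2 * M))).transpose * hubbardCovAboveCT L M β μ 0 0 klE0 *
        hubbardGridSub L M β (2 * (2 * M))) X Y‖ ≤ a * ((2 * (2 * M) : ℕ) : ℝ) / β)
    (hcol : ∀ Y, ∑ X, ‖((hubbardGridSub L M β (2 * (2 * M))).transpose * hubbardCovAboveCT L M β μ 0 0 klE0 *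
        hubbardGridSub L M β (2 * (2 * M))) X Y‖ ≤ a * ((2 * (2 * M) : ℕ) : ℝ) / β)
    (hsmall : 16 * Real.exp 1 ^ 9 * 46 * a * |U| ≤ 1 / 2)
    (ω : GridPoint L (2 * (2 * M)) → GridPoint L (2 * (2 * M)) → ℝ) (hω0 : ∀ p q, 0 ≤ ω p q) (hω1 : ∀ p q, ω p q ≤ 1)
    (σ : Fin 2) (p₀ : GridPoint L (2 * (2 * M))) :
    ∑ p₁ : GridPoint L (2 * (2 * M)), ω p₀ p₁ *
      ‖kernel ℂ (effAction ℂ ((hubbardGridSub L M β (2 * (2 * M))).transpose * hubbardCovAboveCT L M β μ 0 0 klE0 *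
              hubbardGridSub L M β (2 * (2 * M))) (hubbardGridInteraction L (2 * (2 * M)) β U) -
          gaussConv ℂ ((hubbardGridSub L M β (2 * (2 * M))).transpose * hubbardCovAboveCT L M β μ 0 0 klE0 *
              hubbardGridSub L M β (2 * (2 * M))) (hubbardGridInteraction L (2 * (2 * M)) β U) +
          (2 : ℂ)⁻¹ • (gaussConv ℂ ((hubbardGridSub L M β (2 * (2 * M))).transpose * hubbardCovAboveCT L M β μ 0 0 klE0 *
                hubbardGridSub L M β (2 * (2 * M)))
              (hubbardGridInteraction L (2 * (2 * M)) β U * hubbardGridInteraction L (2 * (2 * M)) β U) -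
            gaussConv ℂ ((hubbardGridSub L M β (2 * (2 * M))).transpose * hubbardCovAboveCT L M β μ 0 0 klE0 *
                hubbardGridSub L M β (2 * (2 * M))) (hubbardGridInteraction L (2 * (2 * M)) β U) *
            gaussConv ℂ ((hubbardGridSub L M β (2 * (2 * M))).transpose * hubbardCovAboveCT L M β μ 0 0 klE0 *
                hubbardGridSub L M β (2 * (2 * M))) (hubbardGridInteraction L (2 * (2 * M)) β U)))
        2 (fun i => ((![p₀, p₁] i, σ), i))‖ ≤
      (2 : ℝ) ^ 13 * Real.exp 1 ^ 27 * (46 : ℝ) ^ 3 * a ^ 2 / (10 : ℝ) ^ 74 * |U| * (β / ((2 * (2 * M) : ℕ) : ℝ)) := by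
  have hβ0 : 0 < β := lt_of_lt_of_le (by norm_num [klBetaMin]) hβ
  have hN : (0 : ℝ) < ((2 * (2 * M) : ℕ) : ℝ) := by have := NeZero.ne M; positivity
  have h := twoLeg_wsum_tail3_frameZero_le_of_le_one (L := L) (M := M) hμ hU hβ hL ha hrow hcol hsmall ω hω0 hω1 σ p₀
  refine h.trans ?_
  have h3 := abs_pow_three_le_abs_div_of_le_klEngU₀9 hU hUle
  have hC : 0 ≤ (2 : ℝ) ^ 13 * Real.exp 1 ^ 27 * (46 : ℝ) ^ 3 * a ^ 2 * (β / ((2 * (2 * M) : ℕ) : ℝ)) := by positivity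
  calc (2 : ℝ) ^ 13 * Real.exp 1 ^ 27 * (46 : ℝ) ^ 3 * a ^ 2 * |U| ^ 3 * (β / ((2 * (2 * M) : ℕ) : ℝ))
      = (2 : ℝ) ^ 13 * Real.exp 1 ^ 27 * (46 : ℝ) ^ 3 * a ^ 2 * (β / ((2 * (2 * M) : ℕ) : ℝ)) * |U| ^ 3 := by ring
    _ ≤ (2 : ℝ) ^ 13 * Real.exp 1 ^ 27 * (46 : ℝ) ^ 3 * a ^ 2 * (β / ((2 * (2 * M) : ℕ) : ℝ)) * (|U| / (10 : ℝ) ^ 74) :=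
        mul_le_mul_of_nonneg_left h3 hC
    _ = _ := by ring

end Booked

end Summit.HubbardSuperconductivity.HubbardSuperconductivity.Theorems.EngineV8

end
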